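import Mathlib
import HarnessLib
import Summits.QuantumFields.YangMills.Theorems.ComplexCouplingChannelContinuumLegGivenGapProductToUniformLinearity
import Summits.QuantumFields.YangMills.Theorems.ComplexCouplingChannelContinuumLegGivenGapAlternatingArraysDefs
import Literature.MathematicalPhysics.QuantumLattice.SchwingerGrowthLinearProofs

/-!
# `ContinuumLegGivenGap` (stmt-QuantumFields-15828), line `alternating-curvature-arrays`: `stub_productToUniform`, helper P4a — the LOCALISED k-uniform bound: (PB) on real core-supported tensors ⇒ a bound for EVERY test function, through the tree's E0'' ⇒ E0' engine

Support file for the Whitney / grid-shift / nuclear step `stub_productToUniform` ((PB) ⇒ (UUVB)).  This is the NUCLEAR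
half of the step, discharged onto the landed Osterwalder–Schrader II / Summers engine
`Literature.MathematicalPhysics.QuantumLattice.norm_le_of_isTensorOf_bound` (E0'' ⇒ E0' with constants `A Kⁿ`, `K`
depending only on the one-point space and the order): fix a step `k`, a level `m` (physical cell side
`ℓ = a_k 3^m/2`), an offset `v`, home cells `z i` and REAL Schwartz cut-offs `χ i` supported in the cores
`physCore a_k m v (z i)` with the scale-invariant `C^s` bound `ℓ^j ‖D^j χ_i‖ ≤ M` (`j ≤ s`).  If the product bound
(PB) holds at `k` for real tensors supported in these cores (the inner clause of `ProductBound`, constant `C`, exponent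
`p₀`, flatness order `s`), then for EVERY complex test function `G` on `(ℝ⁴)^p`

  `‖∑_{x ∈ (box L_k)^p} (∏ᵢ χᵢ(a_k xᵢ)) G(a_k x⃗) c_k(x⃗)‖ ≤ (2 C max(ℓ,ℓ⁻¹)^{p₀} (s+1) 2^s M max(1,ℓ)^s K)^p |G|_{p t}`

(`localBound_of_productBound`, registered anchor; `c_k` the centred plaquette-string moments, `t, K` from the engine,
depending on `s` only).  Route: the left side is a continuous linear functional `T` of `G` (finitely many point
evaluations, `NuclearExpansion.delta`); on a tensor `⊗ φᵢ` it is the canonical distribution of the tensor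
`⊗ (χᵢ φᵢ)` (locality, helper P1), which splits into `2^p` REAL tensors `⊗ (re/im)(χᵢ φᵢ)` (`eq_sum_tensorFin_reIm`)
supported in the cores, each bounded by (PB); the cell norms of `re/im (χᵢ φᵢ)` are at most
`(s+1) 2^s M max(1,ℓ)^s |φᵢ|_s` (Leibniz, `norm_iteratedFDeriv_mul_le`; `|re φ|, |im φ| ≤ |φ|` from `SchwartzReIm`).
So `T` satisfies the product hypothesis E0'' with `A = (2 C max(ℓ,ℓ⁻¹)^{p₀} (s+1) 2^s M max(1,ℓ)^s)^p`, and the engine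
gives the bound for all `G`.  What remains of the stub after this file is Whitney bookkeeping: smooth partitions of
the far region into such localised pieces with `|piece|_{pt}` paid by flatness / decay of `F`, plus the near-diagonal
part (helper P2) and the seam.  Mathlib + landed tree lemmas only; no definitions. [folklore]
-/

set_option autoImplicit false

noncomputable section

namespace Summit.QuantumFields.YangMills.Theorems.ContinuumLegGivenGap

open scoped SchwartzMap BigOperators
open MeasureTheory Filter Topology Complex
open Literature.MathematicalPhysics.QuantumFieldTheory Literature.MathematicalPhysics.QuantumLattice
  Literature.MathematicalPhysics.AQFT
open Literature.Probability.LatticeModels (box Site)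
open Summit.QuantumFields.YangMills.Cruxes.ContinuumLimitOnTrajectory.TwoOrbitSynchronisation
  (PlaqIdx plaq canonDistribution)
open Summit.QuantumFields.YangMills.Theorems.ContinuumLimitExists.Negative (centredMoment)
open Summit.QuantumFields.YangMills.Theorems.ContinuumLegGivenGap.AlternatingArrays (cellSide cellNorm physCore)

/-! ## §1 Cut-offs times test functions: the scale-invariant `C^s` bound -/

section CutOff

variable {X : Type*} [NormedAddCommGroup X] [NormedSpace ℝ X]

/-- Derivatives of the complexification of a real test function have the same norms. [folklore] -/
theorem localBound_norm_iteratedFDeriv_ofRealTest (χ : 𝓢(X, ℝ)) (j : ℕ) (y : X) :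
    ‖iteratedFDeriv ℝ j (ofRealTest χ : X → ℂ) y‖ = ‖iteratedFDeriv ℝ j (χ : X → ℝ) y‖ := by
  have hfun : ((ofRealTest χ : 𝓢(X, ℂ)) : X → ℂ) = Complex.ofRealLI.toContinuousLinearMap ∘ χ := rfl
  rw [hfun, Complex.ofRealLI.toContinuousLinearMap.iteratedFDeriv_comp_left ((χ.smooth ⊤).contDiffAt)
    (i := j) (mod_cast le_top), LinearIsometry.norm_compContinuousMultilinearMap]

/-- The product `χ φ` of a real cut-off with a complex test function, as a complex test function
(`smulLeftCLM` by the complexification of `χ`), evaluates pointwise to `χ(y) φ(y)`. [folklore] -/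
theorem localBound_smul_apply (χ : 𝓢(X, ℝ)) (φ : 𝓢(X, ℂ)) (y : X) :
    SchwartzMap.smulLeftCLM ℂ (ofRealTest χ : X → ℂ) φ y = (χ y : ℂ) * φ y := by
  rw [SchwartzMap.smulLeftCLM_apply_apply (ofRealTest χ).hasTemperateGrowth, smul_eq_mul, ofRealTest_apply]

/-- The product `χ φ` is supported in the support of the cut-off. [folklore] -/
theorem localBound_tsupport_smul_subset (χ : 𝓢(X, ℝ)) (φ : 𝓢(X, ℂ)) :
    tsupport (SchwartzMap.smulLeftCLM ℂ (ofRealTest χ : X → ℂ) φ : X → ℂ) ⊆ tsupport (χ : X → ℝ) := by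
  refine closure_mono fun y hy => ?_
  rw [Function.mem_support] at hy ⊢
  intro h0
  exact hy (by rw [localBound_smul_apply, h0, Complex.ofReal_zero, zero_mul])

/-- **Leibniz bound at scale `ℓ`.** If `ℓ^i ‖D^i χ‖ ≤ M` for `i ≤ s`, then for every complex test function `φ` and
`j ≤ s`: `ℓ^j ‖D^j (χ φ)(y)‖ ≤ 2^j M max(1,ℓ)^s |φ|_s`. [folklore] -/
theorem localBound_pow_mul_norm_iteratedFDeriv_smul_le (χ : 𝓢(X, ℝ)) {s : ℕ} {ℓ M : ℝ} (hℓ : 0 < ℓ)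
    (hM : 0 ≤ M) (hχ : ∀ i ≤ s, ∀ y, ℓ ^ i * ‖iteratedFDeriv ℝ i (χ : X → ℝ) y‖ ≤ M) (φ : 𝓢(X, ℂ))
    {j : ℕ} (hj : j ≤ s) (y : X) :
    ℓ ^ j * ‖iteratedFDeriv ℝ j (SchwartzMap.smulLeftCLM ℂ (ofRealTest χ : X → ℂ) φ : X → ℂ) y‖ ≤
      2 ^ j * M * max 1 ℓ ^ s * schwartzNorm s φ := by
  have hfun : (SchwartzMap.smulLeftCLM ℂ (ofRealTest χ : X → ℂ) φ : X → ℂ) =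
      fun y => (ofRealTest χ : X → ℂ) y * φ y := by
    funext y
    rw [localBound_smul_apply, ofRealTest_apply]
  have hLeib := norm_iteratedFDeriv_mul_le (𝕜 := ℝ) (N := (⊤ : ℕ∞)) ((ofRealTest χ).smooth ⊤) (φ.smooth ⊤) y
    (n := j) (mod_cast le_top)
  rw [hfun]
  have hmax1 : (1 : ℝ) ≤ max 1 ℓ := le_max_left _ _
  have hterm : ∀ i ∈ Finset.range (j + 1),
      ℓ ^ j * ((j.choose i : ℝ) * ‖iteratedFDeriv ℝ i (ofRealTest χ : X → ℂ) y‖ *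
        ‖iteratedFDeriv ℝ (j - i) (φ : X → ℂ) y‖) ≤ (j.choose i : ℝ) * (M * max 1 ℓ ^ s * schwartzNorm s φ) := by
    intro i hi
    have hij : i ≤ j := Nat.lt_succ_iff.1 (Finset.mem_range.1 hi)
    have h1 : ℓ ^ i * ‖iteratedFDeriv ℝ i (ofRealTest χ : X → ℂ) y‖ ≤ M := by
      rw [localBound_norm_iteratedFDeriv_ofRealTest]; exact hχ i (hij.trans hj) y
    have h2 : ℓ ^ (j - i) * ‖iteratedFDeriv ℝ (j - i) (φ : X → ℂ) y‖ ≤ max 1 ℓ ^ s * schwartzNorm s φ := by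
      have h3 : ‖iteratedFDeriv ℝ (j - i) (φ : X → ℂ) y‖ ≤ schwartzNorm s φ := by
        have h := SchwartzMap.le_seminorm ℂ 0 (j - i) φ y
        rw [pow_zero, one_mul] at h
        exact h.trans (seminorm_le_schwartzNorm (Nat.zero_le _) (by omega) φ)
      have h4 : ℓ ^ (j - i) ≤ max 1 ℓ ^ s :=
        (pow_le_pow_left₀ hℓ.le (le_max_right 1 ℓ) _).trans (pow_le_pow_right₀ hmax1 (by omega))
      exact mul_le_mul h4 h3 (norm_nonneg _) (by positivity)
    calc ℓ ^ j * ((j.choose i : ℝ) * ‖iteratedFDeriv ℝ i (ofRealTest χ : X → ℂ) y‖ *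
          ‖iteratedFDeriv ℝ (j - i) (φ : X → ℂ) y‖)
        = (j.choose i : ℝ) * ((ℓ ^ i * ‖iteratedFDeriv ℝ i (ofRealTest χ : X → ℂ) y‖) *
            (ℓ ^ (j - i) * ‖iteratedFDeriv ℝ (j - i) (φ : X → ℂ) y‖)) := by
          rw [← pow_sub_mul_pow ℓ hij]; ring
      _ ≤ (j.choose i : ℝ) * (M * (max 1 ℓ ^ s * schwartzNorm s φ)) := by
          refine mul_le_mul_of_nonneg_left ?_ (Nat.cast_nonneg _)
          exact mul_le_mul h1 h2 (by positivity) hM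
      _ = (j.choose i : ℝ) * (M * max 1 ℓ ^ s * schwartzNorm s φ) := by ring
  calc ℓ ^ j * ‖iteratedFDeriv ℝ j (fun y => (ofRealTest χ : X → ℂ) y * φ y) y‖
      ≤ ℓ ^ j * ∑ i ∈ Finset.range (j + 1), (j.choose i : ℝ) * ‖iteratedFDeriv ℝ i (ofRealTest χ : X → ℂ) y‖ *
          ‖iteratedFDeriv ℝ (j - i) (φ : X → ℂ) y‖ := mul_le_mul_of_nonneg_left hLeib (by positivity)
    _ = ∑ i ∈ Finset.range (j + 1), ℓ ^ j * ((j.choose i : ℝ) * ‖iteratedFDeriv ℝ i (ofRealTest χ : X → ℂ) y‖ *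
          ‖iteratedFDeriv ℝ (j - i) (φ : X → ℂ) y‖) := by rw [Finset.mul_sum]
    _ ≤ ∑ i ∈ Finset.range (j + 1), (j.choose i : ℝ) * (M * max 1 ℓ ^ s * schwartzNorm s φ) :=
        Finset.sum_le_sum hterm
    _ = 2 ^ j * M * max 1 ℓ ^ s * schwartzNorm s φ := by
        rw [← Finset.sum_mul]
        have h : ∑ i ∈ Finset.range (j + 1), (j.choose i : ℝ) = 2 ^ j := by exact_mod_cast Nat.sum_range_choose j
        rw [h]; ring

/-- The `C^s` sup-seminorms of `χ φ` at scale `ℓ`: `ℓ^j ‖χ φ‖_{0,j} ≤ 2^j M max(1,ℓ)^s |φ|_s`. [folklore] -/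
theorem localBound_pow_mul_seminorm_smul_le (χ : 𝓢(X, ℝ)) {s : ℕ} {ℓ M : ℝ} (hℓ : 0 < ℓ) (hM : 0 ≤ M)
    (hχ : ∀ i ≤ s, ∀ y, ℓ ^ i * ‖iteratedFDeriv ℝ i (χ : X → ℝ) y‖ ≤ M) (φ : 𝓢(X, ℂ)) {j : ℕ} (hj : j ≤ s) :
    ℓ ^ j * SchwartzMap.seminorm ℂ 0 j (SchwartzMap.smulLeftCLM ℂ (ofRealTest χ : X → ℂ) φ) ≤
      2 ^ j * M * max 1 ℓ ^ s * schwartzNorm s φ := by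
  have hℓj : 0 < ℓ ^ j := pow_pos hℓ j
  have h0 : 0 ≤ 2 ^ j * M * max 1 ℓ ^ s * schwartzNorm s φ := mul_nonneg (by positivity) (schwartzNorm_nonneg _ _)
  rw [mul_comm, ← le_div_iff₀ hℓj]
  refine SchwartzMap.seminorm_le_bound ℂ 0 j _ (div_nonneg h0 hℓj.le) fun y => ?_
  rw [pow_zero, one_mul, le_div_iff₀ hℓj, mul_comm]
  exact localBound_pow_mul_norm_iteratedFDeriv_smul_le χ hℓ hM hχ φ hj y

/-- Real and imaginary parts: the REAL `C^s` seminorms of `re (χ φ)`, `im (χ φ)` are dominated by the complex ones of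
`χ φ`. [folklore] -/
theorem localBound_seminorm_reIm_le (ψ : 𝓢(X, ℂ)) (a b : ℕ) :
    SchwartzMap.seminorm ℝ a b (reTest ψ) ≤ SchwartzMap.seminorm ℂ a b ψ ∧
      SchwartzMap.seminorm ℝ a b (imTest ψ) ≤ SchwartzMap.seminorm ℂ a b ψ := by
  constructor
  · refine (seminorm_le_seminorm_ofRealTest a b _).trans ?_
    refine seminorm_postcomp_le_of_norm_le_one (Complex.ofRealCLM.comp Complex.reCLM) ?_ ψ _ (fun x => rfl) a b
    refine (ContinuousLinearMap.opNorm_comp_le _ _).trans ?_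
    rw [Complex.ofRealCLM_norm, Complex.reCLM_norm, one_mul]
  · refine (seminorm_le_seminorm_ofRealTest a b _).trans ?_
    refine seminorm_postcomp_le_of_norm_le_one (Complex.ofRealCLM.comp Complex.imCLM) ?_ ψ _ (fun x => rfl) a b
    refine (ContinuousLinearMap.opNorm_comp_le _ _).trans ?_
    rw [Complex.ofRealCLM_norm, Complex.imCLM_norm, one_mul]

/-- **Cell norms of the real pieces.** For a real cut-off with `ℓ^i ‖D^i χ‖ ≤ M` (`i ≤ s`) and a complex test
function `φ`, both `cellNorm s ℓ (re (χ φ))` and `cellNorm s ℓ (im (χ φ))` are at most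
`(s+1) 2^s M max(1,ℓ)^s |φ|_s`. [folklore] -/
theorem localBound_cellNorm_reIm_le (χ : 𝓢(EuclideanSpace ℝ (Fin 4), ℝ)) {s : ℕ} {ℓ M : ℝ} (hℓ : 0 < ℓ)
    (hM : 0 ≤ M) (hχ : ∀ i ≤ s, ∀ y, ℓ ^ i * ‖iteratedFDeriv ℝ i (χ : EuclideanSpace ℝ (Fin 4) → ℝ) y‖ ≤ M)
    (φ : 𝓢(EuclideanSpace ℝ (Fin 4), ℂ)) :
    cellNorm s ℓ (reTest (SchwartzMap.smulLeftCLM ℂ (ofRealTest χ : EuclideanSpace ℝ (Fin 4) → ℂ) φ)) ≤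
        (s + 1) * 2 ^ s * M * max 1 ℓ ^ s * schwartzNorm s φ ∧
      cellNorm s ℓ (imTest (SchwartzMap.smulLeftCLM ℂ (ofRealTest χ : EuclideanSpace ℝ (Fin 4) → ℂ) φ)) ≤
        (s + 1) * 2 ^ s * M * max 1 ℓ ^ s * schwartzNorm s φ := by
  set ψ := SchwartzMap.smulLeftCLM ℂ (ofRealTest χ : EuclideanSpace ℝ (Fin 4) → ℂ) φ with hψ
  have hmax1 : (1 : ℝ) ≤ max 1 ℓ := le_max_left _ _
  have hterm : ∀ j ∈ Finset.range (s + 1), ∀ g : 𝓢(EuclideanSpace ℝ (Fin 4), ℝ),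
      SchwartzMap.seminorm ℝ 0 j g ≤ SchwartzMap.seminorm ℂ 0 j ψ →
      ℓ ^ j * SchwartzMap.seminorm ℝ 0 j g ≤ 2 ^ s * M * max 1 ℓ ^ s * schwartzNorm s φ := by
    intro j hj g hg
    have hjs : j ≤ s := Nat.lt_succ_iff.1 (Finset.mem_range.1 hj)
    calc ℓ ^ j * SchwartzMap.seminorm ℝ 0 j g ≤ ℓ ^ j * SchwartzMap.seminorm ℂ 0 j ψ :=
          mul_le_mul_of_nonneg_left hg (pow_nonneg hℓ.le _)
      _ ≤ 2 ^ j * M * max 1 ℓ ^ s * schwartzNorm s φ := localBound_pow_mul_seminorm_smul_le χ hℓ hM hχ φ hjs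
      _ ≤ 2 ^ s * M * max 1 ℓ ^ s * schwartzNorm s φ := by
          have h2 : (2 : ℝ) ^ j ≤ 2 ^ s := pow_le_pow_right₀ one_le_two hjs
          have h0 : 0 ≤ M * max 1 ℓ ^ s * schwartzNorm s φ :=
            mul_nonneg (mul_nonneg hM (by positivity)) (schwartzNorm_nonneg _ _)
          nlinarith
  have hsum : ∀ g : 𝓢(EuclideanSpace ℝ (Fin 4), ℝ), (∀ j, SchwartzMap.seminorm ℝ 0 j g ≤ SchwartzMap.seminorm ℂ 0 j ψ) →
      cellNorm s ℓ g ≤ (s + 1) * 2 ^ s * M * max 1 ℓ ^ s * schwartzNorm s φ := fun g hg => by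
    unfold cellNorm
    calc ∑ j ∈ Finset.range (s + 1), ℓ ^ j * SchwartzMap.seminorm ℝ 0 j g
        ≤ ∑ _j ∈ Finset.range (s + 1), 2 ^ s * M * max 1 ℓ ^ s * schwartzNorm s φ :=
          Finset.sum_le_sum fun j hj => hterm j hj g (hg j)
      _ = (s + 1) * 2 ^ s * M * max 1 ℓ ^ s * schwartzNorm s φ := by
          rw [Finset.sum_const, Finset.card_range, nsmul_eq_mul]; push_cast; ring
  exact ⟨hsum _ fun j => (localBound_seminorm_reIm_le ψ 0 j).1, hsum _ fun j => (localBound_seminorm_reIm_le ψ 0 j).2⟩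

end CutOff

/-- Cell norms are non-negative at a positive scale. [folklore] -/
theorem localBound_cellNorm_nonneg (s : ℕ) {ℓ : ℝ} (hℓ : 0 ≤ ℓ) (f : 𝓢(EuclideanSpace ℝ (Fin 4), ℝ)) :
    0 ≤ cellNorm s ℓ f :=
  Finset.sum_nonneg fun _ _ => mul_nonneg (pow_nonneg hℓ _) (apply_nonneg _ _)

/-! ## §2 The localised lattice functional and its values on tensors -/

section Functional

variable {G : Type} [Group G] [TopologicalSpace G] [IsTopologicalGroup G] [CompactSpace G]
  [MeasurableSpace G] [BorelSpace G]

/-- **The localised lattice functional is continuous linear**: `G ↦ ∑ₓ (∏ᵢ χᵢ(a_k xᵢ)) G(a_k x⃗) c_k(x⃗)` is a finite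
combination of point evaluations (`NuclearExpansion.delta`). [folklore] -/
theorem localBound_exists_clm (r : LatticeRep G) (sch : SpeciesScheme (YMSpecies G)) (k p : ℕ) (q : Fin p → PlaqIdx)
    (χ : Fin p → 𝓢(EuclideanSpace ℝ (Fin 4), ℝ)) :
    ∃ T : 𝓢((Fin p → EuclideanSpace ℝ (Fin 4)), ℂ) →L[ℂ] ℂ, ∀ Gf : 𝓢((Fin p → EuclideanSpace ℝ (Fin 4)), ℂ),
      T Gf = ∑ x : Fin p → ↥(box 4 (sch.L k)), (∏ i, ((χ i (sch.a k • siteToE (↑(x i) : Site 4)) : ℝ) : ℂ)) *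
          Gf (fun i => sch.a k • siteToE (↑(x i) : Site 4)) *
          ((centredMoment r (sch.L k) (sch.β k) p (fun i => some (q i)) (fun i => (x i : Site 4)) : ℝ) : ℂ) := by
  refine ⟨∑ x : Fin p → ↥(box 4 (sch.L k)), ((∏ i, ((χ i (sch.a k • siteToE (↑(x i) : Site 4)) : ℝ) : ℂ)) *
      ((centredMoment r (sch.L k) (sch.β k) p (fun i => some (q i)) (fun i => (x i : Site 4)) : ℝ) : ℂ)) •
      NuclearExpansion.delta (fun i => sch.a k • siteToE (↑(x i) : Site 4)), fun Gf => ?_⟩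
  simp only [FunLike.coe_sum, Finset.sum_apply, FunLike.coe_smul, Pi.smul_apply, NuclearExpansion.delta_apply,
    smul_eq_mul]
  exact Finset.sum_congr rfl fun x _ => by ring

/-- **On tensors the functional is a canonical distribution**: for `F = ⊗ φᵢ`,
`∑ₓ (∏ᵢ χᵢ(a_k xᵢ)) F(a_k x⃗) c_k(x⃗) = canonDistribution (⊗ᵢ (χᵢ φᵢ))` (locality of helper P1). [folklore] -/
theorem localBound_tensor_step (r : LatticeRep G) (sch : SpeciesScheme (YMSpecies G)) (k p : ℕ) (q : Fin p → PlaqIdx)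
    (χ : Fin p → 𝓢(EuclideanSpace ℝ (Fin 4), ℝ)) (φ : Fin p → 𝓢(EuclideanSpace ℝ (Fin 4), ℂ))
    (F : 𝓢((Fin p → EuclideanSpace ℝ (Fin 4)), ℂ)) (hF : IsTensorOf F φ) :
    ∑ x : Fin p → ↥(box 4 (sch.L k)), (∏ i, ((χ i (sch.a k • siteToE (↑(x i) : Site 4)) : ℝ) : ℂ)) *
        F (fun i => sch.a k • siteToE (↑(x i) : Site 4)) *
        ((centredMoment r (sch.L k) (sch.β k) p (fun i => some (q i)) (fun i => (x i : Site 4)) : ℝ) : ℂ) =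
      canonDistribution r sch k p (fun i => plaq r (q i))
        (SchwartzMap.tensorFin p fun i =>
          SchwartzMap.smulLeftCLM ℂ (ofRealTest (χ i) : EuclideanSpace ℝ (Fin 4) → ℂ) (φ i)) := by
  rw [linearity_canonDistribution_eq_sum]
  refine Finset.sum_congr rfl fun x _ => ?_
  rw [SchwartzMap.tensorFin_apply, hF]
  simp only [localBound_smul_apply, Finset.prod_mul_distrib]

/-- **Real splitting of the localised tensor**: `canonDistribution (⊗ᵢ χᵢφᵢ) = ∑_{t ⊆ [p]} i^{p-|t|}
canonDistribution (⊗ᵢ ψᵗᵢ)`, `ψᵗᵢ = re(χᵢφᵢ)` (`i ∈ t`) or `im(χᵢφᵢ)` (`eq_sum_tensorFin_reIm` + linearity). [folklore] -/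
theorem localBound_reIm_split (r : LatticeRep G) (sch : SpeciesScheme (YMSpecies G)) (k p : ℕ) (q : Fin p → PlaqIdx)
    (φ' : Fin p → 𝓢(EuclideanSpace ℝ (Fin 4), ℂ)) :
    canonDistribution r sch k p (fun i => plaq r (q i)) (SchwartzMap.tensorFin p φ') =
      ∑ t : Finset (Fin p), I ^ (p - t.card) *
        canonDistribution r sch k p (fun i => plaq r (q i))
          (SchwartzMap.tensorFin p fun i => ofRealTest (if i ∈ t then reTest (φ' i) else imTest (φ' i))) := by
  have h := eq_sum_tensorFin_reIm φ' (SchwartzMap.tensorFin p φ') (isTensorOf_tensorFin φ')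
  conv_lhs => rw [h]
  rw [linearity_canonDistribution_finset_sum]
  exact Finset.sum_congr rfl fun t _ => linearity_canonDistribution_smul r sch k p q _ _

end Functional

/-! ## §3 The localised k-uniform bound -/

/-- **(PB) at `k` on real core-supported tensors ⇒ a bound for EVERY test function** (registered anchor).  For each
flatness order `s` there are `t, K ≥ 0` (the E0'' ⇒ E0' engine constants of `ℝ⁴`, `norm_le_of_isTensorOf_bound`) such
that: whenever the inner clause of the product bound holds at step `k` for level `m`, offset `v`, cells `z i` with
constant `C ≥ 0` and exponent `p₀`, and `χ i` are real Schwartz cut-offs supported in the cores with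
`ℓ^j ‖D^j χᵢ‖ ≤ M`, `j ≤ s` (`ℓ = a_k 3^m/2`), then for every complex test function `G` on `(ℝ⁴)^p`
`‖∑ₓ (∏ᵢ χᵢ(a_k xᵢ)) G(a_k x⃗) c_k(x⃗)‖ ≤ (2 C max(ℓ,ℓ⁻¹)^{p₀} ((s+1) 2^s M max(1,ℓ)^s) K)^p |G|_{p t}`. [folklore] -/
theorem localBound_of_productBound : ∀ (s : ℕ), ∃ (t : ℕ) (K : ℝ), 0 ≤ K ∧
    ∀ (G : Type) [Group G] [TopologicalSpace G] [IsTopologicalGroup G] [CompactSpace G] [MeasurableSpace G]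
      [BorelSpace G] (r : LatticeRep G) (sch : SpeciesScheme (YMSpecies G)) (k p : ℕ) (q : Fin p → PlaqIdx) (m : ℕ)
      (v : Fin 4 → ℤ) (z : Fin p → Fin 4 → ℤ) (C M : ℝ) (p₀ : ℕ) (χ : Fin p → 𝓢(EuclideanSpace ℝ (Fin 4), ℝ)),
      0 ≤ C → 0 ≤ M →
      (∀ (f : Fin p → 𝓢(EuclideanSpace ℝ (Fin 4), ℝ)) (F : 𝓢((Fin p → EuclideanSpace ℝ (Fin 4)), ℂ)),
        (∀ i, tsupport (f i) ⊆ physCore (sch.a k) m v (z i)) → IsTensorOf F (fun i => ofRealTest (f i)) →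
        ‖canonDistribution r sch k p (fun i => plaq r (q i)) F‖ ≤
          ∏ i, C * max (sch.a k * cellSide m) (sch.a k * cellSide m)⁻¹ ^ p₀ *
            cellNorm s (sch.a k * cellSide m) (f i)) →
      (∀ i, tsupport (χ i) ⊆ physCore (sch.a k) m v (z i)) →
      (∀ i, ∀ j ≤ s, ∀ y, (sch.a k * cellSide m) ^ j * ‖iteratedFDeriv ℝ j (χ i) y‖ ≤ M) →
      ∀ Gf : 𝓢((Fin p → EuclideanSpace ℝ (Fin 4)), ℂ),
        ‖∑ x : Fin p → ↥(box 4 (sch.L k)), (∏ i, ((χ i (sch.a k • siteToE (↑(x i) : Site 4)) : ℝ) : ℂ)) *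
            Gf (fun i => sch.a k • siteToE (↑(x i) : Site 4)) *
            ((centredMoment r (sch.L k) (sch.β k) p (fun i => some (q i)) (fun i => (x i : Site 4)) : ℝ) : ℂ)‖ ≤
          (2 * C * max (sch.a k * cellSide m) (sch.a k * cellSide m)⁻¹ ^ p₀ *
              ((s + 1) * 2 ^ s * M * max 1 (sch.a k * cellSide m) ^ s) * K) ^ p * schwartzNorm (p * t) Gf := by
  intro s
  obtain ⟨t, K, hK0, hmain⟩ := norm_le_of_isTensorOf_bound (E := EuclideanSpace ℝ (Fin 4)) s
  refine ⟨t, K, hK0, ?_⟩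
  intro G _ _ _ _ _ _ r sch k p q m v z C M p₀ χ hC hM hPB hχsupp hχ Gf
  -- notation
  set ℓ : ℝ := sch.a k * cellSide m with hℓdef
  have hℓ : 0 < ℓ := mul_pos (sch.a_pos k) (by unfold cellSide; positivity)
  set B : ℝ := (s + 1) * 2 ^ s * M * max 1 ℓ ^ s with hBdef
  have hB0 : 0 ≤ B := by positivity
  set D : ℝ := C * max ℓ ℓ⁻¹ ^ p₀ with hDdef
  have hD0 : 0 ≤ D := by positivity
  set A : ℝ := (2 * D * B) ^ p with hAdef
  have hA0 : 0 ≤ A := by positivity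
  -- the functional
  obtain ⟨T, hT⟩ := localBound_exists_clm r sch k p q χ
  -- the product hypothesis E0''
  have hE : ∀ (φ : Fin p → 𝓢(EuclideanSpace ℝ (Fin 4), ℂ)) (F : 𝓢((Fin p → EuclideanSpace ℝ (Fin 4)), ℂ)),
      IsTensorOf F φ → ‖T F‖ ≤ A * ∏ i, schwartzNorm s (φ i) := by
    intro φ F hF
    set φ' : Fin p → 𝓢(EuclideanSpace ℝ (Fin 4), ℂ) := fun i =>
      SchwartzMap.smulLeftCLM ℂ (ofRealTest (χ i) : EuclideanSpace ℝ (Fin 4) → ℂ) (φ i) with hφ'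
    rw [hT F, localBound_tensor_step r sch k p q χ φ F hF, localBound_reIm_split]
    -- each of the `2^p` real tensors is bounded by (PB)
    have hterm : ∀ t' : Finset (Fin p),
        ‖I ^ (p - t'.card) * canonDistribution r sch k p (fun i => plaq r (q i))
          (SchwartzMap.tensorFin p fun i => ofRealTest (if i ∈ t' then reTest (φ' i) else imTest (φ' i)))‖ ≤
          ∏ i, D * B * schwartzNorm s (φ i) := by
      intro t'
      rw [norm_mul, norm_pow, Complex.norm_I, one_pow, one_mul]
      set f : Fin p → 𝓢(EuclideanSpace ℝ (Fin 4), ℝ) := fun i => if i ∈ t' then reTest (φ' i) else imTest (φ' i)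
        with hf
      have hfsupp : ∀ i, tsupport (f i) ⊆ physCore (sch.a k) m v (z i) := by
        intro i
        have hφ'supp : tsupport (φ' i : EuclideanSpace ℝ (Fin 4) → ℂ) ⊆ physCore (sch.a k) m v (z i) :=
          (localBound_tsupport_smul_subset (χ i) (φ i)).trans (hχsupp i)
        by_cases hi : i ∈ t'
        · simp only [hf, hi, ↓reduceIte]
          exact (tsupport_reTest_subset (φ' i)).trans hφ'supp
        · simp only [hf, hi, ↓reduceIte]
          exact (tsupport_imTest_subset (φ' i)).trans hφ'supp
      have hPBt := hPB f (SchwartzMap.tensorFin p fun i => ofRealTest (f i)) hfsupp (isTensorOf_tensorFin _)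
      refine hPBt.trans (Finset.prod_le_prod (fun i _ => mul_nonneg hD0 (localBound_cellNorm_nonneg s hℓ.le _))
        fun i _ => ?_)
      have hci : cellNorm s ℓ (f i) ≤ (s + 1) * 2 ^ s * M * max 1 ℓ ^ s * schwartzNorm s (φ i) := by
        have hcn := localBound_cellNorm_reIm_le (χ i) hℓ hM (hχ i) (φ i)
        by_cases hi : i ∈ t'
        · simp only [hf, hi, ↓reduceIte]; exact hcn.1
        · simp only [hf, hi, ↓reduceIte]; exact hcn.2
      calc D * cellNorm s ℓ (f i) ≤ D * ((s + 1) * 2 ^ s * M * max 1 ℓ ^ s * schwartzNorm s (φ i)) :=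
          mul_le_mul_of_nonneg_left hci hD0
        _ = D * B * schwartzNorm s (φ i) := by rw [hBdef]; ring
    calc ‖∑ t' : Finset (Fin p), I ^ (p - t'.card) * canonDistribution r sch k p (fun i => plaq r (q i))
            (SchwartzMap.tensorFin p fun i => ofRealTest (if i ∈ t' then reTest (φ' i) else imTest (φ' i)))‖
        ≤ ∑ t' : Finset (Fin p), ‖I ^ (p - t'.card) * canonDistribution r sch k p (fun i => plaq r (q i))
            (SchwartzMap.tensorFin p fun i => ofRealTest (if i ∈ t' then reTest (φ' i) else imTest (φ' i)))‖ :=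
          norm_sum_le _ _
      _ ≤ ∑ _t' : Finset (Fin p), ∏ i, D * B * schwartzNorm s (φ i) := Finset.sum_le_sum fun t' _ => hterm t'
      _ = 2 ^ p * ∏ i, D * B * schwartzNorm s (φ i) := by
          rw [Finset.sum_const, Finset.card_univ, Fintype.card_finset, Fintype.card_fin, nsmul_eq_mul]
          push_cast; ring
      _ = A * ∏ i, schwartzNorm s (φ i) := by
          rw [hAdef, hDdef, Finset.prod_mul_distrib, Finset.prod_const, Finset.card_univ, Fintype.card_fin]
          ring
  -- the engine
  have h := hmain p T A hA0 hE Gf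
  rw [hT Gf] at h
  refine h.trans (le_of_eq ?_)
  rw [hAdef, ← mul_pow, hDdef]
  ring

end Summit.QuantumFields.YangMills.Theorems.ContinuumLegGivenGap

end
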